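import Literature.Barriers.CriticalPhenomena.GridSAWCountingFixedLengthOfGadgets
import Literature.Barriers.CriticalPhenomena.GridSAWSquaresMachine
import Literature.Barriers.CriticalPhenomena.GridSAWCountingGridHamPathHardnessProofs
import HarnessLib

/-!
# The barrier `GridSAWCountingSharpPComplete` from the gadget step alone

State of the decomposition of `GridSAWCountingSharpPComplete` (Liśkiewicz–Ogihara–Toda 2003,
Theorem 7, versions (1) and (4); `GridSAWCountingSharpPComplete.lean`,
`GridSAWCountingViaGridHamPath.lean`, `GridSAWCountingAnyLengthViaGridHamPath.lean`,
`GridSAWCountingGridHamPathHardness.lean`): of the named facts it was cut into, all but one are now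
DISCHARGED in the tree —

* membership of both versions in `#P`: `LOT2003_thm7_fixedLength_mem_holds`,
  `LOT2003_thm7_anyLength_mem_holds` (`GridSAWCountingVerifier.lean`);
* Proposition 2 for `#3SAT` (parsimonious `#P`-completeness): `LOT2003_prop2_sharp3SAT_holds`
  (`Computability/Complexity/ParsimoniousThreeCNFMachine.lean`);
* Lemma 3 (the normal form, parsimoniously in `FP`): `LOT2003_lemma3_holds`
  (`Computability/Complexity/SharpSATNormalFormFP.lean`);
* the tower step of version (1): `LOT2003_thm7_fixedLength_towers_holds`
  (`GridSAWTowersMachine.lean`, on `GridSAWTowers.lean`, `GridSAWUniformDrawingCount.lean`,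
  `GridSAWTowersEdges.lean`, `GridSAWDrawingChecker.lean`, `GridSAWInstanceCanon.lean`,
  `GridSAWTowersEnumeration.lean`, `GridSAWTowersPieceFn.lean`, `GridSAWTowersReduction.lean`);
* the squares step of version (4): `LOT2003_thm7_anyLength_squares_holds`
  (`GridSAWSquaresMachine.lean` and its siblings).

What remains is the gadget reduction of Lemma 4 with the grid embedding of Theorem 7,
`LOT2003_lemma4_gadgets : #3SAT_NF ≤ᵖ_{r-shift} GRIDHAMPATHCOUNT` (§3 of the source: Tutte-,
XOR-, crossing- and OR-gadgets, the census of Hamiltonian paths per satisfying assignment, and the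
congestion-free grid drawing `E₀`). This file records the one-hypothesis assemblies:

* `LOT2003_thm7_anyLength_of_gadgets : LOT2003_lemma4_gadgets → LOT2003_thm7_anyLength`
  (version (4); version (1) is `LOT2003_thm7_fixedLength_of_gadgets`,
  `GridSAWCountingFixedLengthOfGadgets.lean`);
* **`gridSAWCountingSharpPComplete_of_gadgets : LOT2003_lemma4_gadgets → GridSAWCountingSharpPComplete`**
  — the discharge **`GridSAWCountingSharpPComplete_holds`** (below, 2026-08-15) is this theorem
  applied to `LOT2003_lemma4_gadgets_holds` (`GridSAWCountingGridHamPathHardnessProofs.lean`).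

## References

* M. Liśkiewicz, M. Ogihara, S. Toda, *The complexity of counting self-avoiding walks in
  subgraphs of two-dimensional grids and hypercubes*, TCS 304 (2003) 129–156, Theorem 7 and its
  proof (§4), Lemma 4 (§3), Proposition 2, Lemma 3.
-/

namespace Literature.Barriers.CriticalPhenomena.GridSAW

open Literature.Computability.Complexity (LOT2003_prop2_sharp3SAT_holds)

/-- **What remains of Theorem 7 (4)**: `#P`-completeness of any-length `#SAW(E, s, t)` under
`≤ᵖ_{r-shift}` follows from the gadget reduction with embedding alone.
[cite: LiskiewiczOgiharaToda2003, Theorem 7 (4), proof in §4] -/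
theorem LOT2003_thm7_anyLength_of_gadgets (h4 : LOT2003_lemma4_gadgets) : LOT2003_thm7_anyLength :=
  LOT2003_thm7_anyLength_of LOT2003_thm7_anyLength_mem_holds (LOT2003_lemma4_grid_of_gadgets LOT2003_prop2_sharp3SAT_holds h4)
    LOT2003_thm7_anyLength_squares_holds

/-- **What remains of the barrier**: `GridSAWCountingSharpPComplete` (Theorem 7 (1) ∧ (4)) follows
from the gadget reduction with embedding `LOT2003_lemma4_gadgets` alone — both memberships,
Proposition 2, Lemma 3, the tower step and the squares step being discharged.
[cite: LiskiewiczOgiharaToda2003, Theorem 7 (versions (1) and (4))] -/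
theorem gridSAWCountingSharpPComplete_of_gadgets (h4 : LOT2003_lemma4_gadgets) : GridSAWCountingSharpPComplete :=
  gridSAWCountingSharpPComplete_of_steps LOT2003_thm7_fixedLength_mem_holds LOT2003_thm7_anyLength_mem_holds
    (LOT2003_lemma4_grid_of_gadgets LOT2003_prop2_sharp3SAT_holds h4) LOT2003_thm7_fixedLength_towers_holds
    LOT2003_thm7_anyLength_squares_holds

end Literature.Barriers.CriticalPhenomena.GridSAW

namespace Literature.Barriers.CriticalPhenomena

/-- **The barrier `GridSAWCountingSharpPComplete` holds** (Liśkiewicz–Ogihara–Toda 2003, Theorem 7,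
versions (1) and (4): `#SAW` with fixed length resp. any length between the origin and a given point
in a given finite subgraph of the two-dimensional grid is `#P`-complete under `≤ᵖ_{r-shift}`): the
one-hypothesis assembly `GridSAW.gridSAWCountingSharpPComplete_of_gadgets` (membership of both
versions, Proposition 2, Lemma 3, the tower step and the squares step, all proved in the tree)
applied to the discharge `GridSAW.LOT2003_lemma4_gadgets_holds` of the gadget reduction of Lemma 4
with the grid embedding `E₀` (`GridSAWCountingGridHamPathHardnessProofs.lean`).
[cite: LiskiewiczOgiharaToda2003, Theorem 7 (versions (1) and (4)) and its proof (§4), Lemma 4 (§3)] -/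
theorem GridSAWCountingSharpPComplete_holds : GridSAWCountingSharpPComplete :=
  GridSAW.gridSAWCountingSharpPComplete_of_gadgets GridSAW.LOT2003_lemma4_gadgets_holds

end Literature.Barriers.CriticalPhenomena
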